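import Literature.MathematicalPhysics.StatisticalMechanics.BarlowStackingEnergy
import Literature.MathematicalPhysics.StatisticalMechanics.LennardJonesClusters
import Summits.AtomisticToContinuum.Crystallization.Theorems.PricedLinkCensusTruncatedCensusGapSuperstableRedistribution

/-!
# The affine stacking law for the range-2 truncated Lennard-Jones potential

Stub `barlowSiteEnergy_average_truncLJ_affine` (AFFINE STACKING LAW for the range-2 truncated
Lennard-Jones potential `V_χ = min 1 (max 0 (4 - 2r)) · V_LJ`) of the line
`sharp-m-potential-compactness` for the crux `PricedLinkCensus.TruncatedCensusGap`
(item stmt-AtomisticToContinuum-14230).  The statement at the end is the registered signature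
VERBATIM.

The tree's layer decomposition (`BarlowStackingEnergy.lean`, general pair potential `V`) writes
the energy per particle of a `p`-periodic Hägg word `s` of the Barlow stacking with in-layer
spacing `a` and layer spacing `h` as
`e₀(a,h) + ∑'_{k ≥ 2} J_k(a,h) · alignedFrequency s p k`
(`barlowSiteEnergy_average_eq_tsum_alignedFrequency`), with interlayer couplings
`J_k = Φ_A(k) − Φ_N(k)` (`barlowCoupling`), provided the aligned and non-aligned layer
interactions `k ↦ Φ_A(k)`, `k ↦ Φ_N(k)` are summable.

For a potential `V` VANISHING on `[2, ∞)` and a layer spacing `h` with `3h ≥ 2`, every point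
of a layer at signed layer distance `k` with `|k| ≥ 3` is at distance `≥ |k| h ≥ 3h ≥ 2` from
the base point (the `e₃`-component of `layerVec a h δ k i j` is `k h`), so

* `layerInteraction V a h δ k = 0` for `|k| ≥ 3` (`layerInteraction_eq_zero_of_three_le_abs`),
* the summability hypotheses hold trivially (`summable_layerInteraction_of_vanish`),
* `J_k = 0` for `k ≥ 3` (`barlowCoupling_eq_zero_of_three_le`),

and the `tsum` over `k` collapses to its `k = 2` term: the energy per particle is the AFFINE
function `e₀(a,h) + J₂(a,h) · alignedFrequency s p 2` of the frequency of aligned pairs of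
layers at distance `2` (`barlowSiteEnergy_average_affine_of_vanish`).  The registered statement is the
special case `V = V_χ`, which vanishes on `[2, ∞)` (`truncLJ_eq_zero` of
`PricedLinkCensusTruncatedCensusGapSuperstableRedistribution.lean`).
-/

noncomputable section

namespace Summit.AtomisticToContinuum.Crystallization.Theorems.PricedLinkCensusTruncatedCensusGap

open Literature.MathematicalPhysics.StatisticalMechanics
open Finset

/-! ### Layers at distance `≥ 3` are out of range -/

/-- **Key geometric fact**: if `3h ≥ 2` then every point of a layer at signed layer distance `k`,
`|k| ≥ 3`, is at distance `≥ 2` from the base point — the `e₃`-component of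
`layerVec a h δ k i j` is `k h`, and `|k| h ≥ 3h ≥ 2`. [folklore] -/
theorem two_le_norm_layerVec {h : ℝ} (h3 : 2 ≤ 3 * h) (a : ℝ) (δ i j : ℤ) {k : ℤ}
    (hk : 3 ≤ |k|) : 2 ≤ ‖layerVec a h δ k i j‖ := by
  have hkh : 2 ≤ |(k : ℝ) * h| := by
    rw [abs_mul, abs_of_nonneg (by linarith : (0 : ℝ) ≤ h)]
    have h3' : (3 : ℝ) ≤ |(k : ℝ)| := by exact_mod_cast hk
    nlinarith [abs_nonneg (k : ℝ)]
  calc (2 : ℝ) ≤ |(k : ℝ) * h| := hkh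
    _ = ‖layerVec a h δ k i j 2‖ := by rw [layerVec_apply_two, Real.norm_eq_abs]
    _ ≤ ‖layerVec a h δ k i j‖ := PiLp.norm_apply_le _ _

/-- **Layers at distance `|k| ≥ 3` do not interact** through a potential vanishing on `[2, ∞)`
when `3h ≥ 2`: every term of the lattice sum `layerInteraction V a h δ k` is `V` of a number
`≥ 2`. [folklore] -/
theorem layerInteraction_eq_zero_of_three_le_abs {V : ℝ → ℝ} (hV : ∀ r, 2 ≤ r → V r = 0)
    {h : ℝ} (h3 : 2 ≤ 3 * h) (a : ℝ) (δ : ℤ) {k : ℤ} (hk : 3 ≤ |k|) :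
    layerInteraction V a h δ k = 0 := by
  unfold layerInteraction
  calc ∑' ij : ℤ × ℤ, V ‖layerVec a h δ k ij.1 ij.2‖ = ∑' _ : ℤ × ℤ, (0 : ℝ) :=
      tsum_congr fun ij => hV _ (two_le_norm_layerVec h3 a δ ij.1 ij.2 hk)
    _ = 0 := tsum_zero

/-- The layer interactions of a potential vanishing on `[2, ∞)` are **summable over the layer
distance** when `3h ≥ 2`: they vanish off `Finset.range 3`. [folklore] -/
theorem summable_layerInteraction_of_vanish {V : ℝ → ℝ} (hV : ∀ r, 2 ≤ r → V r = 0)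
    {h : ℝ} (h3 : 2 ≤ 3 * h) (a : ℝ) (δ : ℤ) :
    Summable fun k : ℕ => layerInteraction V a h δ k := by
  refine summable_of_ne_finset_zero (s := range 3) fun k hk => ?_
  rw [mem_range, not_lt] at hk
  exact layerInteraction_eq_zero_of_three_le_abs hV h3 a δ
    (by rw [Nat.abs_cast]; exact_mod_cast hk)

/-- **The interlayer couplings vanish from distance `3` on** for a potential vanishing on
`[2, ∞)` when `3h ≥ 2`: `J_k = Φ_A(k) − Φ_N(k) = 0 − 0`. [folklore] -/
theorem barlowCoupling_eq_zero_of_three_le {V : ℝ → ℝ} (hV : ∀ r, 2 ≤ r → V r = 0)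
    {h : ℝ} (h3 : 2 ≤ 3 * h) (a : ℝ) {k : ℕ} (hk : 3 ≤ k) :
    barlowCoupling V a h k = 0 := by
  have hk' : 3 ≤ |(k : ℤ)| := by rw [Nat.abs_cast]; exact_mod_cast hk
  unfold barlowCoupling
  rw [layerInteraction_eq_zero_of_three_le_abs hV h3 a 0 hk',
    layerInteraction_eq_zero_of_three_le_abs hV h3 a 1 hk', sub_zero]

/-! ### The affine stacking law -/

/-- **Affine stacking law** for a pair potential `V` vanishing on `[2, ∞)` and a layer spacing
with `3h ≥ 2`: the energy per particle of a `p`-periodic Hägg word is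
`e₀(a,h) + J₂(a,h) · alignedFrequency s p 2` — in the layer formula
`e₀ + ∑'_{k ≥ 2} J_k · alignedFrequency s p k` of `BarlowStackingEnergy.lean` every coupling
`J_k`, `k ≥ 3`, vanishes. [folklore] -/
theorem barlowSiteEnergy_average_affine_of_vanish {V : ℝ → ℝ} (hV : ∀ r, 2 ≤ r → V r = 0)
    {a h : ℝ} (h3 : 2 ≤ 3 * h) {s : ℤ → ℤ} (hs : IsHaggSeq s) {p : ℕ} (hp0 : p ≠ 0)
    (hp : ∀ i : ℤ, s (i + p) = s i) :
    (p : ℝ)⁻¹ * ∑ m ∈ range p, barlowSiteEnergy V a h s m =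
      barlowBaseEnergy V a h + barlowCoupling V a h 2 * alignedFrequency s p 2 := by
  rw [inv_mul_eq_div, barlowSiteEnergy_average_eq_tsum_alignedFrequency V a h hs hp0 hp
    (summable_layerInteraction_of_vanish hV h3 a 0)
    (summable_layerInteraction_of_vanish hV h3 a 1), tsum_eq_single 2]
  · rw [if_pos le_rfl]
  · intro k hk
    split_ifs with h2
    · rw [barlowCoupling_eq_zero_of_three_le hV h3 a (by omega), zero_mul]
    · rfl

/-- **AFFINE STACKING LAW for the range-2 truncated Lennard-Jones potential** (registered stub
`barlowSiteEnergy_average_truncLJ_affine` of the line `sharp-m-potential-compactness`):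
for `3h ≥ 2` the interlayer couplings `J_k(V_χ)` vanish for `k ≥ 3`, so the energy per
particle of a `p`-periodic Barlow word is `e₀(a,h) + J₂(a,h) · (aligned frequency at
distance 2)`. [folklore] -/
theorem barlowSiteEnergy_average_truncLJ_affine : ∀ (a h : ℝ) (s : ℤ → ℤ) (p : ℕ), 0 < a → 2 ≤ 3 * h → IsHaggSeq s → p ≠ 0 → (∀ i : ℤ, s (i + p) = s i) → (p : ℝ)⁻¹ * ∑ m ∈ Finset.range p, barlowSiteEnergy (fun r => min 1 (max 0 (4 - 2 * r)) * lennardJones r) a h s m = barlowBaseEnergy (fun r => min 1 (max 0 (4 - 2 * r)) * lennardJones r) a h + barlowCoupling (fun r => min 1 (max 0 (4 - 2 * r)) * lennardJones r) a h 2 * alignedFrequency s p 2 := by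
  intro a h s p _ h3 hs hp0 hp
  exact barlowSiteEnergy_average_affine_of_vanish (fun r hr => truncLJ_eq_zero hr) h3 hs hp0 hp

end Summit.AtomisticToContinuum.Crystallization.Theorems.PricedLinkCensusTruncatedCensusGap
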